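import Mathlib
import Literature.Algebra.Polynomial.CorrelativeSparsityCertificates
import Literature.Algebra.Polynomial.LasserreHierarchy
import HarnessLib

/-!
# Lasserre's SPARSE hierarchy of SOS / moment relaxations: weak duality, comparison with the
# dense hierarchy, and convergence `sup Q*_r = inf Q_r ↑ f*` under the running intersection property

Topic `Literature/Algebra/Polynomial`, namespace
`Literature.Algebra.Polynomial.SparseLasserreHierarchy`.  The degree-truncated companion of
`SparsePutinarPositivstellensatz.lean` (the sparse Putinar representation, Lasserre 2006 Cor. 3.9 /
Grimm–Netzer–Schweighofer 2007) in the format of the tree's dense `LasserreHierarchy.lean`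
(Laurent 2008 (6.2)/(6.3), Theorem 6.8): here the blocks `I_1,…,I_p`, the assignment
`J_1,…,J_p` of constraints to blocks and the degree bound `2r` define Lasserre's sparse programs
`Q_r` (moments) and `Q*_r` (sums of squares), and the convergence `max Q*_r = inf Q_r ↑ f*` is
PROVED from the tree's `sparse_putinar`.

## Source, read on the page

J. B. Lasserre, *Convergent SDP-relaxations in polynomial optimization with sparsity*, SIAM J.
Optim. 17 (2006) 822–843 [held text `paper:doi-10-1137-05064504x`]:
* p. 6, **Assumption 3.1** («there is `M > 0` such that `‖x‖_∞ < M` for all `x ∈ K`»), (3.1)–(3.2):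
  «we add the `p` redundant quadratic constraints `g_{m+k}(X) := n_k M² − ‖X(I_k)‖² ≥ 0,
  k = 1,…,p`, and set `m' = m + p`, so that `K` is now defined by (3.2)
  `K := {x ∈ ℝⁿ | g_j(x) ≥ 0, j = 1,…,m'}`»; **Assumption 3.2**: «the index set `J = {1,…,m'}` is
  partitioned into `p` disjoint sets `J_k` … (i) for every `j ∈ J_k`, `g_j ∈ ℝ[X(I_k)]` …
  (ii) the objective function `f` can be written `f = Σ_k f_k`, `f_k ∈ ℝ[X(I_k)]` … (iii) (1.3)
  holds» (p. 3, (1.3): `I_0 = ∪_k I_k`, together with the running intersection property —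
  Assumption/condition (1.3)–(3.4) of the paper, the tree's `IndexedRunningIntersection`).
* p. 7, (3.5): the sparse moment relaxation `Q_r: inf_y L_y(f)` s.t. `M_r(y, I_k) ⪰ 0`,
  `M_{r−r_j}(g_j y, I_k) ⪰ 0` (`j ∈ J_k`), `y_0 = 1`; p. 9, (3.12): its dual
  «`Q*_r: sup λ` s.t. `f − λ = Σ_{k=1}^p (q_k + Σ_{j ∈ J_k} q_{jk} g_j)`, `q_k, q_{jk} ∈ ℝ[X(I_k)]`
  and s.o.s., `deg q_k, deg q_{jk} g_j ≤ 2r`», «a sparse version of Putinar's representation».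
* p. 9, **Theorem 3.6.** «Let Assumption 3.1 and 3.2 hold … (a) `inf Q_r ↑ min P` as `r → ∞`.
  (b) If `K` has a nonempty interior, then there is no duality gap between `Q_r` and its dual
  `Q*_r`, and `Q*_r` is solvable for sufficiently large `r`»; p. 11 (proof of Cor. 3.9):
  «From Theorem 3.6(a)-(b), we have `inf Q_r = max Q*_r ↑ f*`, as `r → ∞`.»
* J. Nie, J. Demmel, SIAM J. Optim. 19 (2008) [held `paper:arxiv-math_0606476`, p. 6],
  **Theorem 3.1** «`f*_Σ = f*_Δ ≤ f*_sos ≤ f*`» with Remark 3.2 «the lower bound `f*_Δ` given by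
  [the sparse SOS relaxation] is weaker than the SOS lower bound `f*_sos`» (the sparse feasible
  set is contained in the dense one).

## What is formalised (all proved; no named facts; the only inputs are the tree's theorems)

Blocks `I : Fin p → Finset σ`, constraints `g : κ → ℝ[x]` (INCLUDING the redundant ball
constraints (3.1), which are hypothesised to be among them: `SparseAssumptions.ball`), assignment
`J : Fin p → Set κ` (`k ∈ J j` = «`g_k` may carry a multiplier from block `j`»), degree bound `d`
(`= 2r`), objective `f = Σ_j fb j`.
* `sparseTruncModule I g J d` — the set of right-hand sides of (3.12):
  `Σ_j (s₀ j + Σ_{k ∈ J j} s j k · g k)`, `s₀ j, s j k` «in `ℝ[X(I_j)]` and s.o.s.»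
  (`CorrelativeSparsityCertificates.IsBlockSos`), `deg s₀ j ≤ d`, `deg (s j k · g k) ≤ d`;
  `sparseSosFeasible I g J f d = {ρ | f − ρ ∈ …}` — the feasible set of `Q*_r`; monotone in `d`
  (`sparseSosFeasible_mono`), a down-set (`mem_sparseSosFeasible_of_le`), SOUND
  (`le_eval_of_mem_sparseSosFeasible`: `ρ ≤ f(x)` on `K = S(g)`), and contained in the dense
  feasible set of `LasserreHierarchy.sosFeasible` (`sparseSosFeasible_subset_sosFeasible`,
  Nie–Demmel Thm 3.1 `f*_Δ ≤ f*_sos`).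
* `IsSparseMomentFeasible I g J d L` (`L(1) = 1`, `L ≥ 0` on `sparseTruncModule … d`) and
  `sparseMomentValues` — the program `Q_r` (3.5) in functional form (modelling note as in
  `LasserreHierarchy`: `M_r(y, I_k) ⪰ 0` iff `L_y(q²) ≥ 0` for `q ∈ ℝ[X(I_k)]_r`, and
  `M_{r−r_j}(g_j y, I_k) ⪰ 0` iff `L_y(g_j q²) ≥ 0`; `L` is taken on all of `ℝ[x]`, which
  changes neither value set); weak duality `sup Q*_r ≤ inf Q_r ≤ f(x)`
  (`le_of_mem_sparseSosFeasible_of_isSparseMomentFeasible`, `isSparseMomentFeasible_aeval`,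
  `sSup_sparseSosFeasible_le_sInf_sparseMomentValues`, `sInf_sparseMomentValues_le_eval`).
* ★★ `exists_sparse_certificate` — Corollary 3.9 in the exact format (3.12) (each constraint
  multiplied only from its assigned blocks `J`; the ball constraints make every block module
  archimedean), from the tree's `sparse_putinar`; `isCompact_semialgSet_of_balls` — Assumption 3.1
  recovered from the balls and the cover (1.3).
* ★★ `exists_mem_sparseSosFeasible_of_lt` (every strict lower bound of `f` on `K` is feasible for
  `Q*_r` at some finite order), ★★ `tendsto_sSup_sparseSosFeasible` (`sup Q*_r → f*`) and
  ★★ `tendsto_sInf_sparseMomentValues` (`inf Q_r → f*` — Theorem 3.6 (a)), for `K ≠ ∅`, with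
  `f* = inf_{x ∈ K} f(x)` attained (`exists_isMinOn`).

Declared deviations: the `J j` need not be disjoint (Lasserre partitions `J`; Remark 3.5 (i) and
Waki et al. allow overlaps — both are instances); Theorem 3.6 (b) (no duality gap, attainment in
`Q*_r`) and (c) (convergence of first moments to the minimiser) are NOT formalised; the ball
constraints are required to be literally of the form `blockBall (I j) N = N − Σ_{i ∈ I j} x_i²`.

## References

* [Lasserre2006] J. B. Lasserre, SIAM J. Optim. 17 (2006) 822–843 — Assumptions 3.1–3.2, (3.1),
  (3.2), (3.5), (3.12), Theorem 3.6, Corollary 3.9.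
* [NieDemmel2008] J. Nie, J. Demmel, SIAM J. Optim. 19 (2008) 1534–1558 — Theorem 3.1, Remark 3.2.
* [Laurent2008] M. Laurent, *Sums of squares, moment matrices and optimization over polynomials*
  (2009) — (6.2)/(6.3), Theorem 6.8 (the dense format mirrored here, via `LasserreHierarchy`).
-/

noncomputable section

open MvPolynomial Finset Filter

open scoped BigOperators Topology

namespace Literature.Algebra.Polynomial.SparseLasserreHierarchy

open Literature.Algebra.Polynomial.PutinarPositivstellensatz (quadraticModule truncQuadraticModule
  truncQuadraticModule_subset truncQuadraticModule_mono semialgSet IsArchimedeanModule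
  isQuadraticModule_quadraticModule mem_quadraticModule_gen eval_nonneg_of_mem_quadraticModule
  le_eval_of_sub_C_mem_quadraticModule isClosed_semialgSet)
open Literature.Algebra.Polynomial.SparsePutinarPositivstellensatz (C_mem_supported
  rename_mem_supported exists_eq_rename_of_mem_supported sparse_putinar)
open Literature.Algebra.Polynomial.CorrelativeSparsityCertificates (IsBlockSos isBlockSos_zero
  isSumSq_rename blockBall eval_blockBall rename_ball_eq_blockBall)
open Literature.Algebra.Polynomial.LasserreHierarchy (sosFeasible)
open Literature.Combinatorics.SimpleGraph (IndexedRunningIntersection)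

variable {σ : Type*} {p : ℕ} {κ : Type*} [Fintype κ]

/-! ### §1 The sparse programs `Q*_r` (3.12) and `Q_r` (3.5) -/

/-- **The right-hand sides of (3.12) of degree `≤ d`** (`d = 2r`):
`Σ_j (s₀ j + Σ_k s j k · g k)` with `s₀ j`, `s j k` «in `ℝ[X(I_j)]` and s.o.s.», `s j k = 0` unless
`k ∈ J j`, `deg s₀ j ≤ d`, `deg (s j k · g k) ≤ d` — the sparse truncated quadratic module.
[cite: Lasserre2006, (3.12) (p. 9)] -/
def sparseTruncModule (I : Fin p → Finset σ) (g : κ → MvPolynomial σ ℝ) (J : Fin p → Set κ)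
    (d : ℕ) : Set (MvPolynomial σ ℝ) :=
  {q | ∃ (s₀ : Fin p → MvPolynomial σ ℝ) (s : Fin p → κ → MvPolynomial σ ℝ),
    (∀ j, IsBlockSos (I j : Set σ) (s₀ j)) ∧ (∀ j k, IsBlockSos (I j : Set σ) (s j k)) ∧
    (∀ j k, k ∉ J j → s j k = 0) ∧ (∀ j, (s₀ j).totalDegree ≤ d) ∧
    (∀ j k, (s j k * g k).totalDegree ≤ d) ∧ q = ∑ j, (s₀ j + ∑ k, s j k * g k)}

/-- The sparse truncated modules increase with the degree bound. [cite: Lasserre2006, (3.12) (p. 9)] -/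
theorem sparseTruncModule_mono (I : Fin p → Finset σ) (g : κ → MvPolynomial σ ℝ)
    (J : Fin p → Set κ) {d e : ℕ} (hde : d ≤ e) :
    sparseTruncModule I g J d ⊆ sparseTruncModule I g J e := by
  rintro q ⟨s₀, s, hs₀, hs, hJ, hd₀, hd, rfl⟩
  exact ⟨s₀, s, hs₀, hs, hJ, fun j => (hd₀ j).trans hde, fun j k => (hd j k).trans hde, rfl⟩

/-- **Sparse ⊆ dense**: every right-hand side of (3.12) of degree `≤ d` lies in the dense truncated
quadratic module `M(g, d)` (collect `Σ_j s₀ j` and, for each constraint, `Σ_j s j k`) — the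
inclusion behind Nie–Demmel's `f*_Δ ≤ f*_sos`. [cite: NieDemmel2008, Theorem 3.1 and Remark 3.2] -/
theorem sparseTruncModule_subset_truncQuadraticModule (I : Fin p → Finset σ)
    (g : κ → MvPolynomial σ ℝ) (J : Fin p → Set κ) (d : ℕ) :
    sparseTruncModule I g J d ⊆ truncQuadraticModule g d := by
  rintro q ⟨s₀, s, hs₀, hs, -, hd₀, hd, rfl⟩
  refine ⟨∑ j, s₀ j, fun k => ∑ j, s j k, IsSumSq.sum fun j _ => (hs₀ j).isSumSq_and_mem.1,
    fun k => IsSumSq.sum fun j _ => (hs j k).isSumSq_and_mem.1, ?_, fun k => ?_, ?_⟩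
  · exact (totalDegree_finsetSum _ _).trans (Finset.sup_le fun j _ => hd₀ j)
  · rw [Finset.sum_mul]
    exact (totalDegree_finsetSum _ _).trans (Finset.sup_le fun j _ => hd j k)
  · rw [Finset.sum_add_distrib, Finset.sum_comm]
    simp only [Finset.sum_mul]

/-- Hence `sparseTruncModule … ⊆ M(g)`. [cite: NieDemmel2008, Theorem 3.1 and Remark 3.2] -/
theorem sparseTruncModule_subset_quadraticModule (I : Fin p → Finset σ)
    (g : κ → MvPolynomial σ ℝ) (J : Fin p → Set κ) (d : ℕ) :
    sparseTruncModule I g J d ⊆ quadraticModule g :=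
  (sparseTruncModule_subset_truncQuadraticModule I g J d).trans (truncQuadraticModule_subset g d)

/-- **Feasible set of the sparse SOS program `Q*_r`** (3.12) at degree bound `d = 2r`:
`{ρ | f − ρ ∈ sparseTruncModule I g J d}`; `sup Q*_r = sSup` of it. [cite: Lasserre2006, (3.12) (p. 9)] -/
def sparseSosFeasible (I : Fin p → Finset σ) (g : κ → MvPolynomial σ ℝ) (J : Fin p → Set κ)
    (f : MvPolynomial σ ℝ) (d : ℕ) : Set ℝ :=
  {ρ | f - C ρ ∈ sparseTruncModule I g J d}

/-- [cite: Lasserre2006, (3.12) (p. 9)] -/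
theorem mem_sparseSosFeasible_iff (I : Fin p → Finset σ) (g : κ → MvPolynomial σ ℝ)
    (J : Fin p → Set κ) (f : MvPolynomial σ ℝ) (d : ℕ) (ρ : ℝ) :
    ρ ∈ sparseSosFeasible I g J f d ↔ f - C ρ ∈ sparseTruncModule I g J d :=
  Iff.rfl

/-- The feasible sets of `Q*_r` increase with `r`. [cite: Lasserre2006, (3.12) (p. 9)] -/
theorem sparseSosFeasible_mono (I : Fin p → Finset σ) (g : κ → MvPolynomial σ ℝ)
    (J : Fin p → Set κ) (f : MvPolynomial σ ℝ) {d e : ℕ} (hde : d ≤ e) :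
    sparseSosFeasible I g J f d ⊆ sparseSosFeasible I g J f e :=
  fun _ hρ => sparseTruncModule_mono I g J hde hρ

/-- **`sup Q*_r(sparse) ≤ sup Q*_r(dense)`**: the sparse feasible set is contained in the dense one
of `LasserreHierarchy.sosFeasible` at the same degree. [cite: NieDemmel2008, Theorem 3.1 and Remark 3.2] -/
theorem sparseSosFeasible_subset_sosFeasible (I : Fin p → Finset σ) (g : κ → MvPolynomial σ ℝ)
    (J : Fin p → Set κ) (f : MvPolynomial σ ℝ) (d : ℕ) :
    sparseSosFeasible I g J f d ⊆ sosFeasible g f d :=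
  fun _ hρ => sparseTruncModule_subset_truncQuadraticModule I g J d hρ

/-- A block sum of squares plus a nonnegative constant is a block sum of squares.
[cite: Lasserre2006, (3.12) (p. 9)] -/
theorem isBlockSos_add_C {S : Set σ} {s : MvPolynomial σ ℝ} (hs : IsBlockSos S s) {c : ℝ}
    (hc : 0 ≤ c) : IsBlockSos S (s + C c) := by
  obtain ⟨q, hq, rfl⟩ := hs
  refine ⟨q + C (Real.sqrt c) * C (Real.sqrt c), hq.add (IsSumSq.mul_self _), ?_⟩
  rw [map_add, map_mul, rename_C, ← C_mul, Real.mul_self_sqrt hc]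

/-- The feasible set of `Q*_r` is a down-set (add the constant `ρ − ρ'` to `s₀` of the first
block), so `sup Q*_r` is the supremum of an interval. [cite: Lasserre2006, (3.12) (p. 9)] -/
theorem mem_sparseSosFeasible_of_le (hp : 0 < p) {I : Fin p → Finset σ}
    {g : κ → MvPolynomial σ ℝ} {J : Fin p → Set κ} {f : MvPolynomial σ ℝ} {d : ℕ} {ρ ρ' : ℝ}
    (hρ : ρ ∈ sparseSosFeasible I g J f d) (h : ρ' ≤ ρ) : ρ' ∈ sparseSosFeasible I g J f d := by
  classical
  obtain ⟨s₀, s, hs₀, hs, hJ, hd₀, hd, hf⟩ := hρ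
  set j₀ : Fin p := ⟨0, hp⟩
  refine ⟨fun j => s₀ j + if j = j₀ then C (ρ - ρ') else 0, s, fun j => ?_, hs, hJ, fun j => ?_,
    hd, ?_⟩
  · beta_reduce
    by_cases hj : j = j₀
    · rw [if_pos hj]; exact isBlockSos_add_C (hs₀ j) (sub_nonneg.2 h)
    · rw [if_neg hj, add_zero]; exact hs₀ j
  · beta_reduce
    refine (totalDegree_add _ _).trans (max_le (hd₀ j) ?_)
    split_ifs
    · rw [totalDegree_C]; exact Nat.zero_le _
    · rw [totalDegree_zero]; exact Nat.zero_le _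
  · have : f - C ρ' = (f - C ρ) + C (ρ - ρ') := by rw [map_sub]; ring
    rw [this, hf]
    simp only [Finset.sum_add_distrib, Finset.sum_ite_eq', Finset.mem_univ, if_true]
    ring

/-- **Soundness `sup Q*_r ≤ f*`, pointwise**: a feasible `ρ` is a lower bound of `f` on `K = S(g)`.
[cite: Lasserre2006, (3.12) (p. 9)] -/
theorem le_eval_of_mem_sparseSosFeasible {I : Fin p → Finset σ} {g : κ → MvPolynomial σ ℝ}
    {J : Fin p → Set κ} {f : MvPolynomial σ ℝ} {d : ℕ} {ρ : ℝ}
    (hρ : ρ ∈ sparseSosFeasible I g J f d) {x : σ → ℝ} (hx : x ∈ semialgSet g) : ρ ≤ eval x f :=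
  le_eval_of_sub_C_mem_quadraticModule (sparseTruncModule_subset_quadraticModule I g J d hρ) hx

/-- **Feasible functionals of the sparse moment program `Q_r`** (3.5), functional form:
`L(1) = 1` and `L ≥ 0` on `sparseTruncModule I g J d` (i.e. `M_r(y, I_k) ⪰ 0` and
`M_{r−r_j}(g_j y, I_k) ⪰ 0`, `j ∈ J_k`). [cite: Lasserre2006, (3.5) (p. 7)] -/
def IsSparseMomentFeasible (I : Fin p → Finset σ) (g : κ → MvPolynomial σ ℝ) (J : Fin p → Set κ)
    (d : ℕ) (L : MvPolynomial σ ℝ →ₗ[ℝ] ℝ) : Prop :=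
  L 1 = 1 ∧ ∀ q ∈ sparseTruncModule I g J d, 0 ≤ L q

/-- The values `L(f)` of `Q_r`; `inf Q_r = sInf` of this set. [cite: Lasserre2006, (3.5) (p. 7)] -/
def sparseMomentValues (I : Fin p → Finset σ) (g : κ → MvPolynomial σ ℝ) (J : Fin p → Set κ)
    (f : MvPolynomial σ ℝ) (d : ℕ) : Set ℝ :=
  {v | ∃ L : MvPolynomial σ ℝ →ₗ[ℝ] ℝ, IsSparseMomentFeasible I g J d L ∧ L f = v}

/-- Feasibility in `Q_r` is inherited by smaller orders. [cite: Lasserre2006, (3.5) (p. 7)] -/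
theorem IsSparseMomentFeasible.anti {I : Fin p → Finset σ} {g : κ → MvPolynomial σ ℝ}
    {J : Fin p → Set κ} {d e : ℕ} (hde : d ≤ e) {L : MvPolynomial σ ℝ →ₗ[ℝ] ℝ}
    (hL : IsSparseMomentFeasible I g J e L) : IsSparseMomentFeasible I g J d L :=
  ⟨hL.1, fun q hq => hL.2 q (sparseTruncModule_mono I g J hde hq)⟩

/-- A dense-feasible functional (`LasserreHierarchy.IsMomentFeasible`) is sparse-feasible:
`inf Q_r(sparse) ≤ inf Q_r(dense)`. [cite: NieDemmel2008, Theorem 3.1 and Remark 3.2] -/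
theorem isSparseMomentFeasible_of_isMomentFeasible {I : Fin p → Finset σ}
    {g : κ → MvPolynomial σ ℝ} {J : Fin p → Set κ} {d : ℕ} {L : MvPolynomial σ ℝ →ₗ[ℝ] ℝ}
    (hL : LasserreHierarchy.IsMomentFeasible g d L) : IsSparseMomentFeasible I g J d L :=
  ⟨hL.1, fun q hq => hL.2 q (sparseTruncModule_subset_truncQuadraticModule I g J d hq)⟩

/-- **Weak duality `sup Q*_r ≤ inf Q_r`, pointwise**: `ρ ≤ L(f)` for `ρ` feasible in (3.12) and
`L` feasible in (3.5). [cite: Lasserre2006, Theorem 3.6 (b) (p. 9)] -/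
theorem le_of_mem_sparseSosFeasible_of_isSparseMomentFeasible {I : Fin p → Finset σ}
    {g : κ → MvPolynomial σ ℝ} {J : Fin p → Set κ} {f : MvPolynomial σ ℝ} {d : ℕ} {ρ : ℝ}
    (hρ : ρ ∈ sparseSosFeasible I g J f d) {L : MvPolynomial σ ℝ →ₗ[ℝ] ℝ}
    (hL : IsSparseMomentFeasible I g J d L) : ρ ≤ L f := by
  have h := hL.2 _ hρ
  rw [map_sub, C_eq_smul_one, map_smul, hL.1, smul_eq_mul, mul_one, sub_nonneg] at h
  exact h

/-- [cite: Lasserre2006, Theorem 3.6 (b) (p. 9)] -/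
theorem le_of_mem_sparseSosFeasible_of_mem_sparseMomentValues {I : Fin p → Finset σ}
    {g : κ → MvPolynomial σ ℝ} {J : Fin p → Set κ} {f : MvPolynomial σ ℝ} {d : ℕ} {ρ v : ℝ}
    (hρ : ρ ∈ sparseSosFeasible I g J f d) (hv : v ∈ sparseMomentValues I g J f d) : ρ ≤ v := by
  obtain ⟨L, hL, rfl⟩ := hv
  exact le_of_mem_sparseSosFeasible_of_isSparseMomentFeasible hρ hL

/-- **Evaluation at a point of `K` is feasible for `Q_r`** (the Dirac measure; whence
`inf Q_r ≤ f*`). [cite: Lasserre2006, (3.5) (p. 7)] -/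
theorem isSparseMomentFeasible_aeval {I : Fin p → Finset σ} {g : κ → MvPolynomial σ ℝ}
    {J : Fin p → Set κ} (d : ℕ) {x : σ → ℝ} (hx : x ∈ semialgSet g) :
    IsSparseMomentFeasible I g J d (aeval x).toLinearMap := by
  refine ⟨by simp, fun q hq => ?_⟩
  rw [AlgHom.toLinearMap_apply]
  simpa using eval_nonneg_of_mem_quadraticModule
    (sparseTruncModule_subset_quadraticModule I g J d hq) hx

/-- `f(x)` is a value of `Q_r` for every `x ∈ K`. [cite: Lasserre2006, (3.5) (p. 7)] -/
theorem eval_mem_sparseMomentValues {I : Fin p → Finset σ} {g : κ → MvPolynomial σ ℝ}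
    {J : Fin p → Set κ} (f : MvPolynomial σ ℝ) (d : ℕ) {x : σ → ℝ} (hx : x ∈ semialgSet g) :
    eval x f ∈ sparseMomentValues I g J f d :=
  ⟨(aeval x).toLinearMap, isSparseMomentFeasible_aeval d hx, by simp⟩

/-- `sup Q*_r ≤ inf Q_r` in `sSup`/`sInf` form (both programs feasible).
[cite: Lasserre2006, Theorem 3.6 (b) (p. 9)] -/
theorem sSup_sparseSosFeasible_le_sInf_sparseMomentValues {I : Fin p → Finset σ}
    {g : κ → MvPolynomial σ ℝ} {J : Fin p → Set κ} {f : MvPolynomial σ ℝ} {d : ℕ}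
    (hne : (sparseSosFeasible I g J f d).Nonempty) (hne' : (sparseMomentValues I g J f d).Nonempty) :
    sSup (sparseSosFeasible I g J f d) ≤ sInf (sparseMomentValues I g J f d) :=
  csSup_le hne fun _ hρ => le_csInf hne' fun _ hv =>
    le_of_mem_sparseSosFeasible_of_mem_sparseMomentValues hρ hv

/-- `inf Q_r ≤ f(x)` for `x ∈ K` (when `Q*_r` is feasible). [cite: Lasserre2006, (3.5) (p. 7)] -/
theorem sInf_sparseMomentValues_le_eval {I : Fin p → Finset σ} {g : κ → MvPolynomial σ ℝ}
    {J : Fin p → Set κ} {f : MvPolynomial σ ℝ} {d : ℕ}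
    (hne : (sparseSosFeasible I g J f d).Nonempty) {x : σ → ℝ} (hx : x ∈ semialgSet g) :
    sInf (sparseMomentValues I g J f d) ≤ eval x f :=
  csInf_le (let ⟨ρ, hρ⟩ := hne; ⟨ρ, fun _ hv =>
    le_of_mem_sparseSosFeasible_of_mem_sparseMomentValues hρ hv⟩) (eval_mem_sparseMomentValues f d hx)

/-! ### §2 Lasserre's assumptions and the sparse certificate in the format (3.12) -/

/-- **Assumptions 3.1–3.2 and (1.3)** of Lasserre 2006 for blocks `I`, constraints `g` (the list
(3.2), INCLUDING the redundant ball constraints (3.1)), assignment `J` of constraints to blocks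
and block objective `fb`:
`nonempty`/`rip` — the blocks are non-empty and satisfy the running intersection property (3.4);
`cover` — (1.3) `∪_k I_k = {1,…,n}`; `assigned` — 3.2 (i) `g_k ∈ ℝ[X(I_j)]` for `k ∈ J_j`;
`exhaust` — `J = ∪_j J_j`; `ball` — (3.1): each `J_j` contains a ball constraint
`N − ‖X(I_j)‖²`; `objective` — 3.2 (ii) `f_j ∈ ℝ[X(I_j)]`.  (Disjointness of the `J_j` is not
required.) [cite: Lasserre2006, Assumptions 3.1–3.2, (1.3), (3.1)–(3.4) (pp. 3, 6–7)] -/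
structure SparseAssumptions (I : Fin p → Finset σ) (g : κ → MvPolynomial σ ℝ) (J : Fin p → Set κ)
    (fb : Fin p → MvPolynomial σ ℝ) : Prop where
  nonempty : ∀ j, (I j).Nonempty
  rip : IndexedRunningIntersection fun j => (I j : Set σ)
  cover : ∀ i, ∃ j, i ∈ I j
  assigned : ∀ j k, k ∈ J j → g k ∈ supported ℝ (I j : Set σ)
  exhaust : ∀ k, ∃ j, k ∈ J j
  ball : ∀ j, ∃ k ∈ J j, ∃ N : ℝ, g k = blockBall (I j) N
  objective : ∀ j, fb j ∈ supported ℝ (I j : Set σ)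

omit [Fintype κ] in
/-- **Assumption 3.1 from the balls**: if every variable lies in a block and every block carries a
ball constraint, `K = S(g)` is compact. [cite: Lasserre2006, Assumption 3.1 and (3.1) (p. 6)] -/
theorem isCompact_semialgSet_of_balls [Fintype σ] {I : Fin p → Finset σ}
    {g : κ → MvPolynomial σ ℝ} (hcover : ∀ i, ∃ j, i ∈ I j)
    (hball : ∀ j, ∃ k, ∃ N : ℝ, g k = blockBall (I j) N) : IsCompact (semialgSet g) := by
  choose kf Nf hNf using hball
  set R : ℝ := ∑ j, Real.sqrt (max (Nf j) 0)
  have hR : 0 ≤ R := Finset.sum_nonneg fun j _ => Real.sqrt_nonneg _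
  refine Metric.isCompact_of_isClosed_isBounded (isClosed_semialgSet g)
    ((Metric.isBounded_iff_subset_closedBall 0).2 ⟨R, fun x hx => ?_⟩)
  rw [Metric.mem_closedBall, dist_zero_right, pi_norm_le_iff_of_nonneg hR]
  intro i
  obtain ⟨j, hij⟩ := hcover i
  rw [Real.norm_eq_abs]
  have hb : 0 ≤ eval x (g (kf j)) := hx (kf j)
  rw [hNf j, eval_blockBall, sub_nonneg] at hb
  calc |x i| ≤ Real.sqrt (max (Nf j) 0) := Real.abs_le_sqrt
          ((Finset.single_le_sum (fun i' _ => sq_nonneg (x i')) hij).trans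
            (hb.trans (le_max_left _ _)))
    _ ≤ R := Finset.single_le_sum (fun j' _ => Real.sqrt_nonneg (max (Nf j') 0)) (Finset.mem_univ j)

/-- ★★ **Corollary 3.9 in the format (3.12)**: under the assumptions, every `f = Σ_j fb j`
positive on `K` is `Σ_j (s₀ j + Σ_{k ∈ J j} s j k · g k)` with `s₀ j, s j k` «in `ℝ[X(I_j)]` and
s.o.s.» — each constraint multiplied only from its assigned blocks.  The block modules are
archimedean because of the ball constraints, so the tree's `sparse_putinar` applies.
[cite: Lasserre2006, Corollary 3.9 (p. 11) and (3.12) (p. 9)] -/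
theorem exists_sparse_certificate [Fintype σ] {I : Fin p → Finset σ} {g : κ → MvPolynomial σ ℝ}
    {J : Fin p → Set κ} {fb : Fin p → MvPolynomial σ ℝ} (hA : SparseAssumptions I g J fb)
    (hpos : ∀ x ∈ semialgSet g, 0 < eval x (∑ j, fb j)) :
    ∃ (s₀ : Fin p → MvPolynomial σ ℝ) (s : Fin p → κ → MvPolynomial σ ℝ),
      (∀ j, IsBlockSos (I j : Set σ) (s₀ j)) ∧ (∀ j k, IsBlockSos (I j : Set σ) (s j k)) ∧
      (∀ j k, k ∉ J j → s j k = 0) ∧ ∑ j, fb j = ∑ j, (s₀ j + ∑ k, s j k * g k) := by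
  classical
  -- pull the assigned constraints back into the block rings (zero where not assigned)
  have hpull : ∀ (j : Fin p) (k : κ), ∃ q : MvPolynomial ↥(I j : Set σ) ℝ,
      (k ∈ J j → rename ((↑) : ↥(I j : Set σ) → σ) q = g k) ∧ (k ∉ J j → q = 0) := by
    intro j k
    by_cases h : k ∈ J j
    · obtain ⟨q, hq⟩ := exists_eq_rename_of_mem_supported (hA.assigned j k h)
      exact ⟨q, fun _ => hq.symm, fun h' => absurd h h'⟩
    · exact ⟨0, fun h' => absurd h' h, fun _ => rfl⟩
  choose gb hgb_in hgb_out using hpull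
  have hgb : ∀ j k, rename ((↑) : ↥(I j : Set σ) → σ) (gb j k) = if k ∈ J j then g k else 0 := by
    intro j k
    split_ifs with h
    · exact hgb_in j k h
    · rw [hgb_out j k h, map_zero]
  -- archimedean: a ball constraint is among the block generators
  have hArch : ∀ j, IsArchimedeanModule (quadraticModule (gb j)) := by
    intro j
    obtain ⟨k, hk, N, hgk⟩ := hA.ball j
    have hQ := isQuadraticModule_quadraticModule (gb j)
    have hgbk : gb j k = C N - ∑ v : ↥(I j : Set σ), X v ^ 2 := by
      apply rename_injective ((↑) : ↥(I j : Set σ) → σ) Subtype.val_injective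
      rw [hgb_in j k hk, hgk, rename_ball_eq_blockBall]
    refine ⟨⌈N⌉₊, ?_⟩
    have hsplit : (C (⌈N⌉₊ : ℝ) - ∑ v : ↥(I j : Set σ), X v ^ 2 : MvPolynomial ↥(I j : Set σ) ℝ) =
        C ((⌈N⌉₊ : ℝ) - N) + gb j k := by
      rw [hgbk, map_sub]
      ring
    rw [hsplit]
    refine hQ.2.1 _ (hQ.mem_of_isSumSq ?_) _ (mem_quadraticModule_gen _ _)
    have h0 : (0 : ℝ) ≤ (⌈N⌉₊ : ℝ) - N := sub_nonneg.2 (Nat.le_ceil N)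
    rw [show C ((⌈N⌉₊ : ℝ) - N) = C (Real.sqrt ((⌈N⌉₊ : ℝ) - N)) * C (Real.sqrt ((⌈N⌉₊ : ℝ) - N))
      by rw [← C_mul, Real.mul_self_sqrt h0]]
    exact IsSumSq.mul_self _
  -- positivity on the block-constrained set
  have hpos' : ∀ x : σ → ℝ, (∀ j k, 0 ≤ eval (fun v : ↥(I j : Set σ) => x v) (gb j k)) →
      0 < eval x (∑ j, fb j) := by
    intro x hx
    refine hpos x fun k => ?_
    obtain ⟨j, hj⟩ := hA.exhaust k
    have h := hx j k
    rwa [show eval (fun v : ↥(I j : Set σ) => x v) (gb j k) =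
        eval x (rename ((↑) : ↥(I j : Set σ) → σ) (gb j k)) by rw [eval_rename]; rfl,
      hgb, if_pos hj] at h
  obtain ⟨m, hm, hsum⟩ := sparse_putinar (fun j => (I j : Set σ))
    (fun j => Finset.coe_nonempty.2 (hA.nonempty j)) hA.rip gb hArch fb hA.objective hpos'
  -- unpack the block certificates
  have hunpack : ∀ j, ∃ (s₀ : MvPolynomial ↥(I j : Set σ) ℝ) (s : κ → MvPolynomial ↥(I j : Set σ) ℝ),
      IsSumSq s₀ ∧ (∀ k, IsSumSq (s k)) ∧ m j = s₀ + ∑ k, s k * gb j k := fun j => hm j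
  choose s₀ s hs₀ hs hms using hunpack
  refine ⟨fun j => rename ((↑) : ↥(I j : Set σ) → σ) (s₀ j),
    fun j k => if k ∈ J j then rename ((↑) : ↥(I j : Set σ) → σ) (s j k) else 0,
    fun j => ⟨s₀ j, hs₀ j, rfl⟩, fun j k => ?_, fun j k hk => if_neg hk, ?_⟩
  · beta_reduce
    by_cases hk : k ∈ J j
    · rw [if_pos hk]
      exact ⟨s j k, hs j _, rfl⟩
    · rw [if_neg hk]
      exact isBlockSos_zero _
  · rw [hsum]
    refine Finset.sum_congr rfl fun j _ => ?_
    have hk : ∀ k, rename ((↑) : ↥(I j : Set σ) → σ) (s j k) *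
        rename ((↑) : ↥(I j : Set σ) → σ) (gb j k) =
        (if k ∈ J j then rename ((↑) : ↥(I j : Set σ) → σ) (s j k) else 0) * g k := by
      intro k
      rw [hgb]
      split_ifs
      · rfl
      · rw [mul_zero, zero_mul]
    rw [hms j, map_add, map_sum]
    simp only [map_mul, hk]

/-! ### §3 Convergence: Theorem 3.6 (a) and `max Q*_r ↑ f*` -/

/-- `C ρ` placed in the first block: `Σ_j fb' j = Σ_j fb j − ρ`. [cite: Lasserre2006, (3.12) (p. 9)] -/
private theorem sum_sub_ite_C (hp : 0 < p) (fb : Fin p → MvPolynomial σ ℝ) (ρ : ℝ) :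
    ∑ j, (fb j - if j = (⟨0, hp⟩ : Fin p) then C ρ else 0) = ∑ j, fb j - C ρ := by
  classical
  simp only [Finset.sum_sub_distrib, Finset.sum_ite_eq', Finset.mem_univ, if_true]

/-- ★★ **The convergence step** (proof of Theorem 3.6 via Corollary 3.9): every STRICT lower bound
`ρ` of `f = Σ_j fb j` on `K` is feasible for `Q*_r` at some finite order — `f − ρ > 0` on `K` has a
sparse certificate (3.12), whose degrees are bounded. [cite: Lasserre2006, Theorem 3.6 (p. 9) and Corollary 3.9 (p. 11)] -/
theorem exists_mem_sparseSosFeasible_of_lt [Fintype σ] (hp : 0 < p) {I : Fin p → Finset σ}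
    {g : κ → MvPolynomial σ ℝ} {J : Fin p → Set κ} {fb : Fin p → MvPolynomial σ ℝ}
    (hA : SparseAssumptions I g J fb) {ρ : ℝ} (hρ : ∀ x ∈ semialgSet g, ρ < eval x (∑ j, fb j)) :
    ∃ d, ρ ∈ sparseSosFeasible I g J (∑ j, fb j) d := by
  classical
  set fb' : Fin p → MvPolynomial σ ℝ := fun j => fb j - if j = (⟨0, hp⟩ : Fin p) then C ρ else 0
  have hA' : SparseAssumptions I g J fb' :=
    { nonempty := hA.nonempty, rip := hA.rip, cover := hA.cover, assigned := hA.assigned,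
      exhaust := hA.exhaust, ball := hA.ball,
      objective := fun j => Subalgebra.sub_mem _ (hA.objective j) (by
        split_ifs
        · exact C_mem_supported _ _
        · exact Subalgebra.zero_mem _) }
  have hsum' : ∑ j, fb' j = ∑ j, fb j - C ρ := sum_sub_ite_C hp fb ρ
  have hpos : ∀ x ∈ semialgSet g, 0 < eval x (∑ j, fb' j) := fun x hx => by
    rw [hsum', map_sub, eval_C]
    exact sub_pos.2 (hρ x hx)
  obtain ⟨s₀, s, hs₀, hs, hJ, hcert⟩ := exists_sparse_certificate hA' hpos
  refine ⟨max (Finset.univ.sup fun j => (s₀ j).totalDegree)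
      (Finset.univ.sup fun jk : Fin p × κ => (s jk.1 jk.2 * g jk.2).totalDegree),
    s₀, s, hs₀, hs, hJ, fun j => ?_, fun j k => ?_, ?_⟩
  · exact (Finset.le_sup (f := fun j => (s₀ j).totalDegree) (Finset.mem_univ j)).trans
      (le_max_left _ _)
  · exact (Finset.le_sup (f := fun jk : Fin p × κ => (s jk.1 jk.2 * g jk.2).totalDegree)
      (Finset.mem_univ (j, k))).trans (le_max_right _ _)
  · rw [← hsum', hcert]

section Convergence

variable [Fintype σ] {I : Fin p → Finset σ} {g : κ → MvPolynomial σ ℝ} {J : Fin p → Set κ}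
  {fb : Fin p → MvPolynomial σ ℝ}

omit [Fintype κ] in
/-- Under the assumptions the minimum `f* = min_K f` is attained (`K` compact, `K ≠ ∅`).
[cite: Lasserre2006, Theorem 3.6 (p. 9)] -/
theorem exists_isMinOn (hA : SparseAssumptions I g J fb) (hS : (semialgSet g).Nonempty)
    (f : MvPolynomial σ ℝ) : ∃ x ∈ semialgSet g, ∀ y ∈ semialgSet g, eval x f ≤ eval y f := by
  obtain ⟨x, hx, hmin⟩ := (isCompact_semialgSet_of_balls hA.cover
    (fun j => let ⟨k, _, N, h⟩ := hA.ball j; ⟨k, N, h⟩)).exists_isMinOn hS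
    (MvPolynomial.continuous_eval f).continuousOn
  exact ⟨x, hx, fun y hy => hmin hy⟩

omit [Fintype κ] in
/-- `f* = sInf (f '' K) ≤ f(x)` on `K`. [cite: Lasserre2006, Theorem 3.6 (p. 9)] -/
theorem sInf_image_le_eval (hA : SparseAssumptions I g J fb) (f : MvPolynomial σ ℝ) {x : σ → ℝ}
    (hx : x ∈ semialgSet g) : sInf ((fun y => eval y f) '' semialgSet g) ≤ eval x f :=
  csInf_le ((isCompact_semialgSet_of_balls hA.cover
    (fun j => let ⟨k, _, N, h⟩ := hA.ball j; ⟨k, N, h⟩)).bddBelow_image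
    (MvPolynomial.continuous_eval f).continuousOn) (Set.mem_image_of_mem _ hx)

/-- ★★ **`max Q*_r ↑ f*`** (Lasserre 2006, p. 11: «inf Q_r = max Q*_r ↑ f*»; the SOS side of
Theorem 3.6): under Assumptions 3.1–3.2 with the running intersection property and `K ≠ ∅`,
`lim_{r→∞} sup Q*_r = f* = inf_{x ∈ K} f(x)` for `f = Σ_j fb j`, with
`sup Q*_r = sSup (sparseSosFeasible I g J f (2r))` (junk for infeasible small orders; the limit is
unaffected). [cite: Lasserre2006, Theorem 3.6 (p. 9) and p. 11] -/
theorem tendsto_sSup_sparseSosFeasible (hp : 0 < p) (hA : SparseAssumptions I g J fb)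
    (hS : (semialgSet g).Nonempty) :
    Tendsto (fun d => sSup (sparseSosFeasible I g J (∑ j, fb j) d)) atTop
      (𝓝 (sInf ((fun x => eval x (∑ j, fb j)) '' semialgSet g))) := by
  set f := ∑ j, fb j
  set fmin := sInf ((fun x => eval x f) '' semialgSet g)
  have hle : ∀ x ∈ semialgSet g, fmin ≤ eval x f := fun x hx => sInf_image_le_eval hA f hx
  have hub : ∀ d, ∀ ρ ∈ sparseSosFeasible I g J f d, ρ ≤ fmin := fun d ρ hρ =>
    le_csInf (hS.image _) (by
      rintro _ ⟨x, hx, rfl⟩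
      exact le_eval_of_mem_sparseSosFeasible hρ hx)
  have hba : ∀ d, BddAbove (sparseSosFeasible I g J f d) := fun d => ⟨fmin, hub d⟩
  rw [Metric.tendsto_atTop]
  intro ε hε
  obtain ⟨N, hN⟩ := exists_mem_sparseSosFeasible_of_lt hp hA (ρ := fmin - ε / 2)
    (fun x hx => by linarith [hle x hx])
  refine ⟨N, fun d hd => ?_⟩
  have hmem : fmin - ε / 2 ∈ sparseSosFeasible I g J f d := sparseSosFeasible_mono I g J f hd hN
  have h1 : fmin - ε / 2 ≤ sSup (sparseSosFeasible I g J f d) := le_csSup (hba d) hmem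
  have h2 : sSup (sparseSosFeasible I g J f d) ≤ fmin := csSup_le ⟨_, hmem⟩ (hub d)
  rw [Real.dist_eq, abs_lt]
  constructor <;> linarith

/-- ★★ **Theorem 3.6 (a): `inf Q_r ↑ f*`** — the sparse moment relaxations converge to the global
minimum, `lim_{r→∞} inf Q_r = inf_{x ∈ K} f(x)` (sandwiched between `sup Q*_r` and `f*` by weak
duality). [cite: Lasserre2006, Theorem 3.6 (a) (p. 9)] -/
theorem tendsto_sInf_sparseMomentValues (hp : 0 < p) (hA : SparseAssumptions I g J fb)
    (hS : (semialgSet g).Nonempty) :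
    Tendsto (fun d => sInf (sparseMomentValues I g J (∑ j, fb j) d)) atTop
      (𝓝 (sInf ((fun x => eval x (∑ j, fb j)) '' semialgSet g))) := by
  set f := ∑ j, fb j
  set fmin := sInf ((fun x => eval x f) '' semialgSet g)
  have hle : ∀ x ∈ semialgSet g, fmin ≤ eval x f := fun x hx => sInf_image_le_eval hA f hx
  rw [Metric.tendsto_atTop]
  intro ε hε
  obtain ⟨N, hN⟩ := exists_mem_sparseSosFeasible_of_lt hp hA (ρ := fmin - ε / 2)
    (fun x hx => by linarith [hle x hx])
  refine ⟨N, fun d hd => ?_⟩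
  have hmem : fmin - ε / 2 ∈ sparseSosFeasible I g J f d := sparseSosFeasible_mono I g J f hd hN
  obtain ⟨x₀, hx₀⟩ := hS
  have h1 : fmin - ε / 2 ≤ sInf (sparseMomentValues I g J f d) :=
    le_csInf ⟨_, eval_mem_sparseMomentValues f d hx₀⟩
      fun _ hv => le_of_mem_sparseSosFeasible_of_mem_sparseMomentValues hmem hv
  have h2 : sInf (sparseMomentValues I g J f d) ≤ fmin :=
    le_csInf (Set.Nonempty.image _ ⟨x₀, hx₀⟩) (by
      rintro _ ⟨x, hx, rfl⟩
      exact sInf_sparseMomentValues_le_eval ⟨_, hmem⟩ hx)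
  rw [Real.dist_eq, abs_lt]
  constructor <;> linarith

omit [Fintype σ] in
/-- The three values in one line at every order `d` past feasibility: `sup Q*_d ≤ inf Q_d ≤ f*`.
[cite: Lasserre2006, Theorem 3.6 (p. 9)] -/
theorem sSup_le_sInf_le_fmin (hS : (semialgSet g).Nonempty)
    {d : ℕ} (hne : (sparseSosFeasible I g J (∑ j, fb j) d).Nonempty) :
    sSup (sparseSosFeasible I g J (∑ j, fb j) d) ≤ sInf (sparseMomentValues I g J (∑ j, fb j) d) ∧
      sInf (sparseMomentValues I g J (∑ j, fb j) d) ≤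
        sInf ((fun x => eval x (∑ j, fb j)) '' semialgSet g) := by
  obtain ⟨x₀, hx₀⟩ := hS
  refine ⟨sSup_sparseSosFeasible_le_sInf_sparseMomentValues hne
      ⟨_, eval_mem_sparseMomentValues _ d hx₀⟩,
    le_csInf (Set.Nonempty.image _ ⟨x₀, hx₀⟩) ?_⟩
  rintro _ ⟨x, hx, rfl⟩
  exact sInf_sparseMomentValues_le_eval hne hx

end Convergence

end Literature.Algebra.Polynomial.SparseLasserreHierarchy
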